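import Summits.RiemannHypothesis.RiemannHypothesis.Theorems.UniversalFactorNarrowKernelNoGoEnergyLowerKernel
import Literature.NumberTheory.LFunctions.HardyZFirstApprox

/-!
# RiemannHypothesis / UniversalFactor — `NarrowKernelNoGo`, line `Sketch`, stub K1a (energy lower
bound): the test coefficients `q_n = κ̂_a(L − log n)` on the window `N/e² < n ≤ N/e`

Route `RiemannHypothesis/UniversalFactor`, crux `NarrowKernelNoGo` (stmt-RiemannHypothesis-2576), stub
`UniversalFactor.stub_narrowEnergyLowerClean` (lead). With `κ_a(u) = e^{−2a|u|} e^{−πu/4}`, `L = log N`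
(`N = √(T'/2π)`), the duality argument tests the smoothed Hardy function against the Dirichlet polynomial
with coefficients `conj(q_n) n^{-1/2}`, `q_n = ∫ κ_a(u) e^{iu(L − log n)} du`, supported on the window
`V = (N/e², N/e]` where `L − log n ∈ [1, 2]`. This file records the sizes of these coefficients:

* `UniversalFactor.norm_narrowCoeff_le` — `‖q_n‖ ≤ K₀ := ∫ κ_a`;
* `UniversalFactor.norm_narrowCoeff_ge` — `‖q_n‖ ≥ m_a := 4a/(2a + π/4 + 2)²` on the window;
* `UniversalFactor.narrowWindow_sum_inv_ge` / `_le` — `1/2 ≤ Σ_{n ∈ V} 1/n ≤ 3` (for `N ≥ 42`);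
* consequences for `Σ_V ‖q_n‖²/n`, `Σ_V ‖q_n‖²`, `Σ_V ‖q_n‖ n^{-1/2}`.

References: Titchmarsh (1986) §7.3; crux idea card `lorentz-filter-energy-gap`.
-/

noncomputable section

-- D-0017: `Summit.<S>.<S>.…` is the designed namespace of a single-problem summit.
set_option linter.dupNamespace false

namespace Summit.RiemannHypothesis.RiemannHypothesis.Theorems

open MeasureTheory Set Filter Complex intervalIntegral
open scoped Real Topology ComplexConjugate
open Literature.NumberTheory.LFunctions Literature.NumberTheory.LFunctions.TwistedMoment

/-! ## The coefficient `q_n(ω) = κ̂_a(ω)` at `ω = L − log n` -/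

/-- `‖κ̂_a(ω)‖ ≤ ∫ κ_a` (any real `ω`), restated with the frequency written `L − log n`. [folklore] -/
theorem UniversalFactor.norm_narrowCoeff_le (a L : ℝ) (n : ℕ) :
    ‖∫ u : ℝ, ((Real.exp (-(2 * a * |u|)) * Real.exp (-(π * u / 4)) : ℝ) : ℂ) * cexp (I * (L - Real.log n) * u)‖ ≤
      ∫ u : ℝ, Real.exp (-(2 * a * |u|)) * Real.exp (-(π * u / 4)) := by
  have := UniversalFactor.norm_narrowKer_fourier_le a (L - Real.log n)
  simpa only [Complex.ofReal_sub] using this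

/-- On the window `N/e² < n ≤ N/e` (`N = e^L`) the frequency `L − log n` lies in `[1, 2]`. [folklore] -/
theorem UniversalFactor.narrowWindow_freq_mem {L : ℝ} {n : ℕ} (hn : 1 ≤ n)
    (hlo : Real.exp L / Real.exp 2 < n) (hhi : (n : ℝ) ≤ Real.exp L / Real.exp 1) :
    1 ≤ L - Real.log n ∧ L - Real.log n ≤ 2 := by
  have hn0 : (0 : ℝ) < n := by exact_mod_cast hn
  constructor
  · -- `n ≤ e^{L-1}` ⇒ `log n ≤ L - 1`
    have h1 : (n : ℝ) ≤ Real.exp (L - 1) := by rwa [Real.exp_sub]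
    have := Real.log_le_log hn0 h1
    rw [Real.log_exp] at this
    linarith
  · have h1 : Real.exp (L - 2) < n := by rwa [Real.exp_sub]
    have := Real.log_lt_log (Real.exp_pos _) h1
    rw [Real.log_exp] at this
    linarith

/-- **Lower bound on the window**: for `a > π/8` and `N/e² < n ≤ N/e`,
`‖q_n‖ ≥ 4a/(2a + π/4 + 2)²`. [folklore] -/
theorem UniversalFactor.norm_narrowCoeff_ge {a : ℝ} (ha : π / 8 < a) {L : ℝ} {n : ℕ} (hn : 1 ≤ n)
    (hlo : Real.exp L / Real.exp 2 < n) (hhi : (n : ℝ) ≤ Real.exp L / Real.exp 1) :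
    4 * a / (2 * a + π / 4 + 2) ^ 2 ≤
      ‖∫ u : ℝ, ((Real.exp (-(2 * a * |u|)) * Real.exp (-(π * u / 4)) : ℝ) : ℂ) * cexp (I * (L - Real.log n) * u)‖ := by
  obtain ⟨h1, h2⟩ := UniversalFactor.narrowWindow_freq_mem hn hlo hhi
  have habs : |L - Real.log n| ≤ 2 := by rw [abs_le]; constructor <;> linarith
  have := UniversalFactor.norm_narrowKer_fourier_ge ha (ω := L - Real.log n) (W := 2) habs
  simpa only [Complex.ofReal_sub] using this

/-- The window lower bound is a positive number. [folklore] -/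
theorem UniversalFactor.narrowCoeff_lower_pos {a : ℝ} (ha : π / 8 < a) : 0 < 4 * a / (2 * a + π / 4 + 2) ^ 2 := by
  have hπ := Real.pi_pos
  have : 0 < 2 * a + π / 4 + 2 := by linarith
  exact div_pos (by linarith) (pow_pos this 2)

/-! ## The window `V = Icc (⌊N/e²⌋ + 1) ⌊N/e⌋` and its harmonic sum -/

/-- Membership in the window gives the real inequalities `N/e² < n ≤ N/e` and `1 ≤ n`. [folklore] -/
theorem UniversalFactor.narrowWindow_mem {N : ℝ} (hN : 0 ≤ N) {n : ℕ}
    (hn : n ∈ Finset.Icc (⌊N / Real.exp 2⌋₊ + 1) ⌊N / Real.exp 1⌋₊) :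
    1 ≤ n ∧ N / Real.exp 2 < n ∧ (n : ℝ) ≤ N / Real.exp 1 := by
  rw [Finset.mem_Icc] at hn
  refine ⟨by omega, ?_, ?_⟩
  · have : ⌊N / Real.exp 2⌋₊ < n := by omega
    exact (Nat.floor_lt (by positivity)).1 this
  · exact (Nat.le_floor_iff (by positivity)).1 hn.2

/-- The window has at least `N/e − N/e² − 2` and at most `N/e` elements. [folklore] -/
theorem UniversalFactor.narrowWindow_card {N : ℝ} (hN : 0 ≤ N) :
    N / Real.exp 1 - N / Real.exp 2 - 2 ≤ ((Finset.Icc (⌊N / Real.exp 2⌋₊ + 1) ⌊N / Real.exp 1⌋₊).card : ℝ) ∧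
      ((Finset.Icc (⌊N / Real.exp 2⌋₊ + 1) ⌊N / Real.exp 1⌋₊).card : ℝ) ≤ N / Real.exp 1 := by
  rw [Nat.card_Icc]
  have h1 : (⌊N / Real.exp 1⌋₊ : ℝ) ≤ N / Real.exp 1 := Nat.floor_le (by positivity)
  have h2 : N / Real.exp 1 - 1 < ⌊N / Real.exp 1⌋₊ := by
    have := Nat.lt_floor_add_one (N / Real.exp 1); linarith
  have h3 : (⌊N / Real.exp 2⌋₊ : ℝ) ≤ N / Real.exp 2 := Nat.floor_le (by positivity)
  have hle : ⌊N / Real.exp 2⌋₊ ≤ ⌊N / Real.exp 1⌋₊ := by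
    refine Nat.floor_mono ?_
    exact div_le_div_of_nonneg_left hN (Real.exp_pos 1) (Real.exp_le_exp.2 (by norm_num))
  have hcast : ((⌊N / Real.exp 1⌋₊ + 1 - (⌊N / Real.exp 2⌋₊ + 1) : ℕ) : ℝ) =
      (⌊N / Real.exp 1⌋₊ : ℝ) - ⌊N / Real.exp 2⌋₊ := by
    rw [Nat.add_sub_add_right, Nat.cast_sub hle]
  rw [hcast]
  have h4 : (0 : ℝ) ≤ ⌊N / Real.exp 2⌋₊ := Nat.cast_nonneg _
  constructor
  · linarith
  · linarith

/-- **Harmonic sum over the window**: `1/2 ≤ Σ_{n ∈ V} 1/n ≤ 3` for `N ≥ 42`. [folklore] -/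
theorem UniversalFactor.narrowWindow_sum_inv {N : ℝ} (hN : 42 ≤ N) :
    1 / 2 ≤ ∑ n ∈ Finset.Icc (⌊N / Real.exp 2⌋₊ + 1) ⌊N / Real.exp 1⌋₊, (1 : ℝ) / n ∧
      ∑ n ∈ Finset.Icc (⌊N / Real.exp 2⌋₊ + 1) ⌊N / Real.exp 1⌋₊, (1 : ℝ) / n ≤ 3 := by
  have hN0 : 0 ≤ N := by linarith
  set V := Finset.Icc (⌊N / Real.exp 2⌋₊ + 1) ⌊N / Real.exp 1⌋₊ with hV
  obtain ⟨hc1, hc2⟩ := UniversalFactor.narrowWindow_card hN0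
  have he1 : Real.exp 1 < 2.7182818286 := Real.exp_one_lt_d9
  have he1' : 2.7182818283 < Real.exp 1 := Real.exp_one_gt_d9
  have he2 : Real.exp 2 = Real.exp 1 * Real.exp 1 := by rw [← Real.exp_add]; norm_num
  have hepos : 0 < Real.exp 1 := Real.exp_pos 1
  -- each term is between `e/N` and `e²/N`
  have hlo : ∀ n ∈ V, Real.exp 1 / N ≤ (1 : ℝ) / n := by
    intro n hn
    obtain ⟨h1, _, h3⟩ := UniversalFactor.narrowWindow_mem hN0 hn
    have hn0 : (0 : ℝ) < n := by exact_mod_cast h1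
    rw [div_le_div_iff₀ (by linarith) hn0, one_mul]
    rw [le_div_iff₀ hepos] at h3
    linarith
  have hhi : ∀ n ∈ V, (1 : ℝ) / n ≤ Real.exp 2 / N := by
    intro n hn
    obtain ⟨h1, h2, _⟩ := UniversalFactor.narrowWindow_mem hN0 hn
    have hn0 : (0 : ℝ) < n := by exact_mod_cast h1
    rw [div_le_div_iff₀ hn0 (by linarith), one_mul]
    rw [div_lt_iff₀ (by positivity)] at h2
    linarith
  constructor
  · calc (1 : ℝ) / 2 ≤ (N / Real.exp 1 - N / Real.exp 2 - 2) * (Real.exp 1 / N) := by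
          rw [he2]
          field_simp
          nlinarith
      _ ≤ (V.card : ℝ) * (Real.exp 1 / N) := mul_le_mul_of_nonneg_right hc1 (by positivity)
      _ = ∑ n ∈ V, Real.exp 1 / N := by rw [Finset.sum_const, nsmul_eq_mul]
      _ ≤ ∑ n ∈ V, (1 : ℝ) / n := Finset.sum_le_sum hlo
  · calc ∑ n ∈ V, (1 : ℝ) / n ≤ ∑ n ∈ V, Real.exp 2 / N := Finset.sum_le_sum hhi
      _ = (V.card : ℝ) * (Real.exp 2 / N) := by rw [Finset.sum_const, nsmul_eq_mul]
      _ ≤ N / Real.exp 1 * (Real.exp 2 / N) := mul_le_mul_of_nonneg_right hc2 (by positivity)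
      _ = Real.exp 1 := by rw [he2]; field_simp
      _ ≤ 3 := by linarith

/-! ## Consequences for the test coefficients -/

/-- `Σ_{n ∈ V} ‖q_n‖²/n ≥ m_a²/2` for `N = e^L ≥ 42`. [folklore] -/
theorem UniversalFactor.narrowCoeff_energy_ge {a : ℝ} (ha : π / 8 < a) {L : ℝ} (hN : 42 ≤ Real.exp L) :
    (4 * a / (2 * a + π / 4 + 2) ^ 2) ^ 2 / 2 ≤
      ∑ n ∈ Finset.Icc (⌊Real.exp L / Real.exp 2⌋₊ + 1) ⌊Real.exp L / Real.exp 1⌋₊,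
        ‖∫ u : ℝ, ((Real.exp (-(2 * a * |u|)) * Real.exp (-(π * u / 4)) : ℝ) : ℂ) *
          cexp (I * (L - Real.log n) * u)‖ ^ 2 / n := by
  set m : ℝ := 4 * a / (2 * a + π / 4 + 2) ^ 2 with hm
  have hm0 : 0 < m := UniversalFactor.narrowCoeff_lower_pos ha
  obtain ⟨hs, _⟩ := UniversalFactor.narrowWindow_sum_inv hN
  have hN0 : 0 ≤ Real.exp L := (Real.exp_pos L).le
  calc m ^ 2 / 2 ≤ m ^ 2 * ∑ n ∈ Finset.Icc (⌊Real.exp L / Real.exp 2⌋₊ + 1) ⌊Real.exp L / Real.exp 1⌋₊,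
        (1 : ℝ) / n := by
          rw [div_eq_mul_one_div]
          exact mul_le_mul_of_nonneg_left hs (by positivity)
    _ = ∑ n ∈ Finset.Icc (⌊Real.exp L / Real.exp 2⌋₊ + 1) ⌊Real.exp L / Real.exp 1⌋₊, m ^ 2 / n := by
          rw [Finset.mul_sum]
          refine Finset.sum_congr rfl fun n _ => by ring
    _ ≤ _ := by
          refine Finset.sum_le_sum fun n hn => ?_
          obtain ⟨h1, h2, h3⟩ := UniversalFactor.narrowWindow_mem hN0 hn
          have hq := UniversalFactor.norm_narrowCoeff_ge ha h1 h2 h3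
          have hn0 : (0 : ℝ) < n := by exact_mod_cast h1
          exact div_le_div_of_nonneg_right (pow_le_pow_left₀ hm0.le hq 2) hn0.le

/-- `Σ_{n ∈ V} ‖q_n‖²/n ≤ 3 K₀²`, `K₀ = ∫ κ_a`, for `N = e^L ≥ 42`. [folklore] -/
theorem UniversalFactor.narrowCoeff_energy_le (a : ℝ) {L : ℝ} (hN : 42 ≤ Real.exp L) :
    ∑ n ∈ Finset.Icc (⌊Real.exp L / Real.exp 2⌋₊ + 1) ⌊Real.exp L / Real.exp 1⌋₊,
        ‖∫ u : ℝ, ((Real.exp (-(2 * a * |u|)) * Real.exp (-(π * u / 4)) : ℝ) : ℂ) *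
          cexp (I * (L - Real.log n) * u)‖ ^ 2 / n ≤
      3 * (∫ u : ℝ, Real.exp (-(2 * a * |u|)) * Real.exp (-(π * u / 4))) ^ 2 := by
  set K₀ : ℝ := ∫ u : ℝ, Real.exp (-(2 * a * |u|)) * Real.exp (-(π * u / 4)) with hK₀
  have hK₀0 : 0 ≤ K₀ := integral_nonneg fun u => (UniversalFactor.narrowKer_pos a u).le
  obtain ⟨_, hs⟩ := UniversalFactor.narrowWindow_sum_inv hN
  have hN0 : 0 ≤ Real.exp L := (Real.exp_pos L).le
  calc _ ≤ ∑ n ∈ Finset.Icc (⌊Real.exp L / Real.exp 2⌋₊ + 1) ⌊Real.exp L / Real.exp 1⌋₊, K₀ ^ 2 / n := by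
          refine Finset.sum_le_sum fun n hn => ?_
          obtain ⟨h1, _, _⟩ := UniversalFactor.narrowWindow_mem hN0 hn
          have hq := UniversalFactor.norm_narrowCoeff_le a L n
          have hn0 : (0 : ℝ) < n := by exact_mod_cast h1
          exact div_le_div_of_nonneg_right (pow_le_pow_left₀ (norm_nonneg _) hq 2) hn0.le
    _ = K₀ ^ 2 * ∑ n ∈ Finset.Icc (⌊Real.exp L / Real.exp 2⌋₊ + 1) ⌊Real.exp L / Real.exp 1⌋₊, (1 : ℝ) / n := by
          rw [Finset.mul_sum]
          refine Finset.sum_congr rfl fun n _ => by ring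
    _ ≤ K₀ ^ 2 * 3 := mul_le_mul_of_nonneg_left hs (by positivity)
    _ = 3 * K₀ ^ 2 := by ring

/-- `Σ_{n ∈ V} ‖q_n‖² ≤ (N/e) K₀² ≤ N K₀²` (`N = e^L`). [folklore] -/
theorem UniversalFactor.narrowCoeff_sq_sum_le (a L : ℝ) :
    ∑ n ∈ Finset.Icc (⌊Real.exp L / Real.exp 2⌋₊ + 1) ⌊Real.exp L / Real.exp 1⌋₊,
        ‖∫ u : ℝ, ((Real.exp (-(2 * a * |u|)) * Real.exp (-(π * u / 4)) : ℝ) : ℂ) *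
          cexp (I * (L - Real.log n) * u)‖ ^ 2 ≤
      Real.exp L * (∫ u : ℝ, Real.exp (-(2 * a * |u|)) * Real.exp (-(π * u / 4))) ^ 2 := by
  set K₀ : ℝ := ∫ u : ℝ, Real.exp (-(2 * a * |u|)) * Real.exp (-(π * u / 4)) with hK₀
  have hN0 : 0 ≤ Real.exp L := (Real.exp_pos L).le
  obtain ⟨_, hc2⟩ := UniversalFactor.narrowWindow_card hN0
  calc _ ≤ ∑ n ∈ Finset.Icc (⌊Real.exp L / Real.exp 2⌋₊ + 1) ⌊Real.exp L / Real.exp 1⌋₊, K₀ ^ 2 :=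
        Finset.sum_le_sum fun n _ => pow_le_pow_left₀ (norm_nonneg _) (UniversalFactor.norm_narrowCoeff_le a L n) 2
    _ = ((Finset.Icc (⌊Real.exp L / Real.exp 2⌋₊ + 1) ⌊Real.exp L / Real.exp 1⌋₊).card : ℝ) * K₀ ^ 2 := by
        rw [Finset.sum_const, nsmul_eq_mul]
    _ ≤ Real.exp L / Real.exp 1 * K₀ ^ 2 := mul_le_mul_of_nonneg_right hc2 (by positivity)
    _ ≤ Real.exp L * K₀ ^ 2 := by
        refine mul_le_mul_of_nonneg_right ?_ (by positivity)
        rw [div_le_iff₀ (Real.exp_pos 1)]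
        have : 1 ≤ Real.exp 1 := Real.one_le_exp one_pos.le
        nlinarith [Real.exp_pos L]

/-- `Σ_{n ∈ V} ‖q_n‖ n^{-1/2} ≤ 2 K₀ √P` when `V ⊆ [1, P]`. [folklore] -/
theorem UniversalFactor.narrowCoeff_l1_le (a L : ℝ) {P : ℕ} (hP : ⌊Real.exp L / Real.exp 1⌋₊ ≤ P) :
    ∑ n ∈ Finset.Icc (⌊Real.exp L / Real.exp 2⌋₊ + 1) ⌊Real.exp L / Real.exp 1⌋₊,
        ‖∫ u : ℝ, ((Real.exp (-(2 * a * |u|)) * Real.exp (-(π * u / 4)) : ℝ) : ℂ) *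
          cexp (I * (L - Real.log n) * u)‖ * (n : ℝ) ^ (-(1 / 2 : ℝ)) ≤
      2 * (∫ u : ℝ, Real.exp (-(2 * a * |u|)) * Real.exp (-(π * u / 4))) * Real.sqrt P := by
  set K₀ : ℝ := ∫ u : ℝ, Real.exp (-(2 * a * |u|)) * Real.exp (-(π * u / 4)) with hK₀
  have hK₀0 : 0 ≤ K₀ := integral_nonneg fun u => (UniversalFactor.narrowKer_pos a u).le
  have hsub : Finset.Icc (⌊Real.exp L / Real.exp 2⌋₊ + 1) ⌊Real.exp L / Real.exp 1⌋₊ ⊆ Finset.Icc 1 P := by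
    intro n hn
    rw [Finset.mem_Icc] at hn ⊢
    omega
  calc _ ≤ ∑ n ∈ Finset.Icc (⌊Real.exp L / Real.exp 2⌋₊ + 1) ⌊Real.exp L / Real.exp 1⌋₊, K₀ * (n : ℝ) ^ (-(1 / 2 : ℝ)) :=
        Finset.sum_le_sum fun n _ => mul_le_mul_of_nonneg_right (UniversalFactor.norm_narrowCoeff_le a L n)
          (Real.rpow_nonneg (Nat.cast_nonneg n) _)
    _ ≤ ∑ n ∈ Finset.Icc 1 P, K₀ * (n : ℝ) ^ (-(1 / 2 : ℝ)) :=
        Finset.sum_le_sum_of_subset_of_nonneg hsub fun n _ _ => mul_nonneg hK₀0 (Real.rpow_nonneg (Nat.cast_nonneg n) _)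
    _ = K₀ * ∑ n ∈ Finset.Icc 1 P, (n : ℝ) ^ (-(1 / 2 : ℝ)) := by rw [Finset.mul_sum]
    _ ≤ K₀ * (2 * Real.sqrt P) := mul_le_mul_of_nonneg_left (sum_Icc_rpow_neg_half_le P) hK₀0
    _ = 2 * K₀ * Real.sqrt P := by ring

/-- Registered sub-stub `narrowCoeffs_lower_pos` of crux `stmt-RiemannHypothesis-2576` (binder-free restatement of
`UniversalFactor.narrowCoeff_lower_pos`, used by the gate to attach this helper file to the crux). [folklore] -/
theorem UniversalFactor.narrowCoeffs_lower_pos : ∀ {a : ℝ}, Real.pi / 8 < a → 0 < 4 * a / (2 * a + Real.pi / 4 + 2) ^ 2 :=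
  fun ha => UniversalFactor.narrowCoeff_lower_pos ha

end Summit.RiemannHypothesis.RiemannHypothesis.Theorems
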